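import Summits.QuantumFields.YangMills.Theses.UniversalDetector
import Summits.QuantumFields.YangMills.Theorems.UniversalDetectorRigidityOfSemigroupKill
import Summits.QuantumFields.YangMills.Theorems.UniversalDetectorSemigroupKillReduction
import Summits.QuantumFields.YangMills.Theorems.UniversalDetectorMirrorCauchySchwarz
import Summits.QuantumFields.YangMills.Theorems.UniversalDetectorSliceIdentity

/-!
# Route `UniversalDetector`: the crux `DetectorRigidity` (stmt-QuantumFields-26595) holds

Ideator seat ym-idea-8 g4 (lens «dual»).  Composition of the landed pieces:
`sliceIdentity` + `mirrorCauchySchwarz` ⟹ (`semigroupKill_of_slice_of_cs`) skeleton stub 1 `Stmt_semigroupKill`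
⟹ (`detectorRigidity_of_semigroupKill`, which packages stub 2 `gaussDeconv` and stub 3 `symmetrySpread`) the route
item `Summit.QuantumFields.YangMills.Theses.UniversalDetector.DetectorRigidity`: a reflection-positive, Euclidean- and
ϑ-symmetric two-point kernel of a local field that annihilates one Gaussian-profile positive-time test vector vanishes
off the origin ("OS rigidity of the universal detector").  This is the route's rank-3 structural crux; the deciding
crux `NonContactScheme` (rank 2) and the residual `SkewAtScheme` remain open, and no summit, leg or spine statement is
proved here.
-/

set_option autoImplicit false

namespace Summit.QuantumFields.YangMills.Cruxes.DetectorRigidity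

/-- **The crux `DetectorRigidity` of route `UniversalDetector` holds.** -/
theorem detectorRigidity : Summit.QuantumFields.YangMills.Theses.UniversalDetector.DetectorRigidity :=
  detectorRigidity_of_semigroupKill (semigroupKill_of_slice_of_cs sliceIdentity mirrorCauchySchwarz)

end Summit.QuantumFields.YangMills.Cruxes.DetectorRigidity
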